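import Summits.ABC.ABC.Theses.CubicResolventAllowance
import HarnessLib

/-!
# STUB-IDEAS `stub_realCubic` · ideator k3 · generation 12 — THE SIGN HAS TEETH (real-class habitat of the parity organ)

Crux stmt-ABC-22740 `CubicResolventAllowance.IndexSzpiro`, stub `stub_realCubic`, route-ABC-CubicResolventAllowance.
HOME FAMILY 3 (probe the extremes), gen 12 = closing page of the family.  Eleven k3 pages found NO use of the stub's
sign hypothesis `0 < d_K` beyond a parity coset (k2 g10).  This page finds the first one, at the lone-tower extreme of
gen 11: the parity organ `EvenTowerAllowance M A ∧ NoCubicFieldDvd A ⇒ n_p odd at N = M·p` dies at `M = 11` ONLY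
THROUGH COMPLEX fields (`K₋₄₄ = ℚ(11a[2])`, `K₋₁₀₄`, `K₋₇₆`, `K₋₂₃`, `K₋₂₀₀`, …); on the REAL class it survives for
every tame cofactor `M ≤ 36` (first real obstruction `M = 37`, `d_K = 148 ∣ 296`), because the totally real cubic
fields of discriminant `≤ 280 = max_{M ≤ 36} A(M)` are exactly `d ∈ {49, 81, 148, 169, 229, 257}` (R1) and none of
these divides an allowance `A(M)`, `M ≤ 36`, `27 ∤ M` (R1′, `decide`).  R1 is tree-closable: Delone–Faddeev
(`exists_ringOfForm_ringEquiv_ringOfIntegers`, `disc_eq_discr_of_ringEquiv_ringOfIntegers`,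
`isIrreducible_of_ringEquiv_ringOfIntegers`) + Hessian reduction (`exists_gl2zEquiv_hessianReduced`, `sq_a_le_of_reduced`,
`sq_b_le_of_reduced`, `hessP_sq_le_disc`, `GL2ZEquiv.disc_eq`, `GL2ZEquiv.isIrreducible_iff`) put the index form of `𝓞_K`
in the box `|a| ≤ 1, |b| ≤ 5, |c| ≤ 13, |d| ≤ 9`, where the decidable certificate `RealFormCert280` (R0; 222 reduced forms;
PROVED below by one kernel `decide`, ≈ 20 s on the farm) lists the discriminants.  Data (calc/realcubics.py,
calc/complexcubics.py — Hessian / Mathews reduction + BST local maximality; 27 real and 126 complex field discriminants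
of absolute value ≤ 1000, matching the classical tables): obstructed cofactors `M ≤ 200` — REAL 27 (`27, 37, 49, 54, 71,
74, 79, 81, 98, 101, 108, 111, 127, 135, 141, 142, 147, 148, 158, 162, 163, 169, 173, 185, 189, 196, 197`), COMPLEX 123.
Kit j345295 (sign-split tower census) tests the prediction; kit j345277 (Cremona-population census) could not run
(PARI `elldata` absent on calc nodes).  Verdict on the stub unchanged: open-problem (kernel = K-free odd-tower Szpiro,
k2 B4 / k3 G10); the parity organ constrains parity, never size.  One sorry: R1 (L, mechanical from R0 + the named tree lemmas).
-/

namespace Summit.ABC.ABC.Cruxes.IndexSzpiro.StubIdeas3G12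

open Summit.ABC.ABC.Theses.CubicResolventAllowance
open Polynomial

/-! ## §0 The stub (verbatim) -/

/-- The registered stub `stub_realCubic`, verbatim. -/
def StubRealCubic : Prop :=
  ∀ ε : ℝ, 0 < ε → ∃ C : ℝ, ∀ (W : WeierstrassCurve ℚ) [W.IsElliptic] (K : Type) [Field K] [NumberField K],
    Irreducible W.twoTorsionPolynomial.toPoly → Module.finrank ℚ K = 3 →
    (∃ θ : K, aeval θ W.twoTorsionPolynomial.toPoly = 0) → 0 < NumberField.discr K →
    (W.minimalDiscriminantNorm ℤ : ℝ) ≤ C * |(NumberField.discr K : ℝ)| * (W.conductorNorm ℤ : ℝ) ^ (6 + ε)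

/-! ## §1 The totally real cubic fields of discriminant ≤ 280 -/

/-- The six totally real cubic discriminants `≤ 280`. -/
def smallRealCubicDiscs : Finset ℤ := {49, 81, 148, 169, 229, 257}

/-- `Disc(a,b,c,d) = b²c² − 4ac³ − 4b³d − 27a²d² + 18abcd` (= `BinaryCubic.disc_eq`). -/
def discZ (a b c d : ℤ) : ℤ :=
  b ^ 2 * c ^ 2 - 4 * a * c ^ 3 - 4 * b ^ 3 * d - 27 * a ^ 2 * d ^ 2 + 18 * a * b * c * d

/-- **R0 (decidable certificate — PROVED: one kernel `decide` over the 16 929-tuple box, ≈ 20 s; 222 reduced forms).**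
Every Hessian-reduced integral form (`|Q| ≤ P ≤ R`) in the box `|a| ≤ 1, |b| ≤ 5, |c| ≤ 13, |d| ≤ 9` with
`0 < Disc ≤ 280` has `Disc ∈ {49,81,148,169,229,257}`, or `a = 0`, or an integral zero `(r : 1)`, `|r| ≤ 9`
(so is reducible).  Verified by brute force (calc/certcheck.py). -/
def RealFormCert280 : Prop :=
  ∀ a ∈ Finset.Icc (-1 : ℤ) 1, ∀ b ∈ Finset.Icc (-5 : ℤ) 5, ∀ c ∈ Finset.Icc (-13 : ℤ) 13, ∀ d ∈ Finset.Icc (-9 : ℤ) 9,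
    |b * c - 9 * a * d| ≤ b ^ 2 - 3 * a * c → b ^ 2 - 3 * a * c ≤ c ^ 2 - 3 * b * d →
    0 < discZ a b c d → discZ a b c d ≤ 280 →
    discZ a b c d ∈ smallRealCubicDiscs ∨ a = 0 ∨ ∃ r ∈ Finset.Icc (-9 : ℤ) 9, a * r ^ 3 + b * r ^ 2 + c * r + d = 0

set_option maxHeartbeats 8000000 in
set_option maxRecDepth 4000 in
theorem realFormCert280 : RealFormCert280 := by
  unfold RealFormCert280 smallRealCubicDiscs discZ
  decide

/-- Calibration: the single `(a,b) = (1,0)` slice (instant) — slices are the fallback if the one-shot `decide` ever regresses. -/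
example : ∀ c ∈ Finset.Icc (-13 : ℤ) 13, ∀ d ∈ Finset.Icc (-9 : ℤ) 9,
    |(0 : ℤ) * c - 9 * 1 * d| ≤ (0 : ℤ) ^ 2 - 3 * 1 * c → (0 : ℤ) ^ 2 - 3 * 1 * c ≤ c ^ 2 - 3 * 0 * d →
    0 < discZ 1 0 c d → discZ 1 0 c d ≤ 280 →
    discZ 1 0 c d ∈ smallRealCubicDiscs ∨ (1 : ℤ) = 0 ∨
      ∃ r ∈ Finset.Icc (-9 : ℤ) 9, 1 * r ^ 3 + 0 * r ^ 2 + c * r + d = 0 := by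
  decide

/-- **R1 (L, tree-closable from R0).**  A cubic number field with `0 < d_K ≤ 280` has
`d_K ∈ {49, 81, 148, 169, 229, 257}`.  Chain: `exists_ringOfForm_ringEquiv_ringOfIntegers` gives `f` with
`R(f) ≃ 𝓞_K`, `disc_eq_discr_of_ringEquiv_ringOfIntegers` gives `Disc f = d_K > 0`, `isIrreducible_of_ringEquiv_ringOfIntegers`
irreducibility; `exists_gl2zEquiv_hessianReduced` + `GL2ZEquiv.disc_eq` + `GL2ZEquiv.isIrreducible_iff` a reduced
equivalent `g`; `hessP_sq_le_disc` (`P ≤ 16`), `sq_a_le_of_reduced` (`|a| ≤ 1`), `sq_b_le_of_reduced` (`|b| ≤ 5`),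
`P = b² − 3ac`, `|Q| ≤ P` (`|c| ≤ 13`, `|d| ≤ 9`) the box; R0 + `eval_ratPoly_div_eq_zero` +
`Polynomial.degree_eq_one_of_irreducible_of_root` exclude the reducible alternatives. [cite: DeloneFaddeev1964, §15;
Davenport1951CubicFormsI, Lemma 1] -/
theorem real_cubic_discr_le_280 (K : Type) [Field K] [NumberField K] (hK : Module.finrank ℚ K = 3)
    (hpos : 0 < NumberField.discr K) (hle : NumberField.discr K ≤ 280) :
    NumberField.discr K ∈ smallRealCubicDiscs := by
  sorry

-- (cited CubicFields declarations verified by `rg` in the tree: CubicFieldForms.lean:60,75,83; HessianReduction.lean:126,218,224,230;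
--  BinaryCubicForms.lean:315; DeloneFaddeevIrreducible.lean:299 — not imported here while the CubicFields build is stale)

/-! ## §2 The real-class parity organ: every tame cofactor `M ≤ 36` -/

/-- No TOTALLY REAL cubic field has `d_K ∣ A` (the real refinement of G11's `NoCubicFieldDvd A`). -/
def NoRealCubicFieldDvd (A : ℕ) : Prop :=
  ∀ (K : Type) [Field K] [NumberField K], Module.finrank ℚ K = 3 → 0 < NumberField.discr K →
    ¬ (NumberField.discr K).natAbs ∣ A

/-- The even-tower allowance table `A(M)` for the tame cofactors `M ≤ 36` (`27 ∤ M`):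
`A(M) = 8 · 3^{[3 ∣ M]} · ∏_{q ∥ M, q ≥ 5} q · ∏_{q² ∣ M, q ≥ 5} q²` (k3 G8 H1–H3 / G11, tame `c₃ = 1`). -/
def allowanceTable36 : List (ℕ × ℕ) :=
  [(1, 8), (2, 8), (3, 24), (4, 8), (5, 40), (6, 24), (7, 56), (8, 8), (9, 24), (10, 40), (11, 88), (12, 24),
   (13, 104), (14, 56), (15, 120), (16, 8), (17, 136), (18, 24), (19, 152), (20, 40), (21, 168), (22, 88), (23, 184),
   (24, 24), (25, 200), (26, 104), (28, 56), (29, 232), (30, 120), (31, 248), (32, 8), (33, 264), (34, 136), (35, 280),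
   (36, 24)]

/-- The finite arithmetic behind R1′: every table entry is `≤ 280` and no `d ∈ {49,81,148,169,229,257}` divides it. -/
theorem allowanceTable36_clean :
    ∀ MA ∈ allowanceTable36, MA.2 ≤ 280 ∧ ∀ s ∈ smallRealCubicDiscs, ¬ s ∣ (MA.2 : ℤ) := by
  decide

/-- **R1′ (S from R1, PROVED here modulo R1).**  For every tame cofactor `M ≤ 36` no totally real cubic field has
`d_K ∣ A(M)` — whereas (calc/complexcubics.py = G11 census j345203) complex ones exist for
`M ∈ {11,13,19,22,23,25,26,29,31,33,35}`. -/
theorem noRealCubicFieldDvd_of_mem_table {M A : ℕ} (h : (M, A) ∈ allowanceTable36) : NoRealCubicFieldDvd A := by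
  intro K _ _ hK hpos hdvd
  obtain ⟨hle, hnd⟩ := allowanceTable36_clean (M, A) h
  have hApos : 0 < A := by
    have : (M, A) ∈ allowanceTable36 := h
    simp only [allowanceTable36, List.mem_cons, Prod.mk.injEq, List.not_mem_nil, or_false] at this
    omega
  have hdle : NumberField.discr K ≤ 280 := by
    have h1 : (NumberField.discr K).natAbs ≤ A := Nat.le_of_dvd hApos hdvd
    have h2 : ((NumberField.discr K).natAbs : ℤ) = NumberField.discr K := Int.natAbs_of_nonneg hpos.le
    omega
  have hmem := real_cubic_discr_le_280 K hK hpos hdle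
  refine hnd _ hmem ?_
  have : ((NumberField.discr K).natAbs : ℤ) ∣ (A : ℤ) := Int.natCast_dvd_natCast.mpr hdvd
  rwa [Int.natAbs_of_nonneg hpos.le] at this

/-- G11's even-tower allowance schema at cofactor `M` (verbatim from `StubIdeas3G11.EvenTowerAllowance`; k3 G8 H1–H3,
tame `c₃`; census-validated j345203, 0 exceptions): an EVEN lone tower at `p` forces `|d_K| ∣ A`. -/
def EvenTowerAllowance (M A : ℕ) : Prop :=
  ∀ (W : WeierstrassCurve ℚ) [W.IsElliptic] (K : Type) [Field K] [NumberField K],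
    Irreducible W.twoTorsionPolynomial.toPoly → Module.finrank ℚ K = 3 →
    (∃ θ : K, aeval θ W.twoTorsionPolynomial.toPoly = 0) →
    ∀ p : ℕ, p.Prime → p ≠ 2 → ¬ p ∣ M → W.conductorNorm ℤ = M * p →
      Even ((W.minimalDiscriminantNorm ℤ).factorization p) → (NumberField.discr K).natAbs ∣ A

/-- **R2 (S, PROVED modulo R1 and the allowance schema) — the real-class lone tower is ODD for every tame cofactor
`M ≤ 36`.**  On the complex class this fails from `M = 11` on (`11a`-type towers: 13 even towers at `N = 37p` on
`d_K = 148` in j345203 show the real bound `36` is sharp too). -/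
theorem realLoneTowerOdd36 {M A : ℕ} (hMA : (M, A) ∈ allowanceTable36) (hA : EvenTowerAllowance M A)
    (W : WeierstrassCurve ℚ) [W.IsElliptic] (K : Type) [Field K] [NumberField K]
    (hirr : Irreducible W.twoTorsionPolynomial.toPoly) (hK : Module.finrank ℚ K = 3)
    (hθ : ∃ θ : K, aeval θ W.twoTorsionPolynomial.toPoly = 0) (hreal : 0 < NumberField.discr K)
    {p : ℕ} (hp : p.Prime) (hp2 : p ≠ 2) (hpM : ¬ p ∣ M) (hN : W.conductorNorm ℤ = M * p) :
    Odd ((W.minimalDiscriminantNorm ℤ).factorization p) := by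
  rcases Nat.even_or_odd ((W.minimalDiscriminantNorm ℤ).factorization p) with h | h
  · exact absurd (hA W K hirr hK hθ p hp hp2 hpM hN h) (noRealCubicFieldDvd_of_mem_table hMA K hK hreal)
  · exact h

/-! ## §3 What the organ does NOT give (the stub's kernel is size, not parity) -/

/-- **R3 (the honest gap, = k2 B4 / k3 G10 kernel).**  The K-free odd-tower statement the stub reduces to on the
habitat of R2: an odd lone tower of a real-class curve of conductor `M·p` is `≤ C(M,ε) · p^{6+ε}`-small.  Open
(Szpiro-strength at fixed cofactor; known ceiling `n_p ≪ p log p`, Pasten).  Not used above; recorded as the target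
the parity organ cannot touch. -/
def OddTowerSzpiroAt (M : ℕ) : Prop :=
  ∀ ε : ℝ, 0 < ε → ∃ C : ℝ, ∀ (W : WeierstrassCurve ℚ) [W.IsElliptic] (K : Type) [Field K] [NumberField K],
    Irreducible W.twoTorsionPolynomial.toPoly → Module.finrank ℚ K = 3 →
    (∃ θ : K, aeval θ W.twoTorsionPolynomial.toPoly = 0) → 0 < NumberField.discr K →
    ∀ p : ℕ, p.Prime → ¬ p ∣ M → W.conductorNorm ℤ = M * p →
      ((p : ℝ) ^ (W.minimalDiscriminantNorm ℤ).factorization p) ≤ C * (p : ℝ) ^ (6 + ε)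

end Summit.ABC.ABC.Cruxes.IndexSzpiro.StubIdeas3G12
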